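import Mathlib
import Literature.Analysis.FluidPDE.AxisymmetricEuler
import HarnessLib

/-!
# Crux `EulerZoomLiouville.PowerGaugeEulerLiouville` (stmt-NavierStokesRegularity-19832), sub-line `casimir_haul` (H3 `stub_haulingInequality`):
# SLICING `ℝ³` ALONG THE SYMMETRY AXIS — the measure-preserving map `(y, t) ↦ (y₀, y₁, t)` and its calculus

Route №10 `EulerZoomLiouville` (NavierStokesRegularity), crux E = stmt-NavierStokesRegularity-19832; width seat ns-ezl-w2 g7 under the LEAD ns-typeII-p2.
The hauling inequality (H3) is proved slice by slice in the planes `{x₃ = t}`.  This file is the plumbing between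
`ℝ³ = EuclideanSpace ℝ (Fin 3)` and `ℝ² × ℝ` (`ℝ² = EuclideanSpace ℝ (Fin 2)`), with the slice map written EXPLICITLY as
`(y, t) ↦ toLp 2 ![y 0, y 1, t]` (no new definition):

* `insertNth_two_eq` — `Fin.insertNth 2 t y = ![y 0, y 1, t]`;
* `measurePreserving_sliceMap` — `(y, t) ↦ (y₀, y₁, t)` is MEASURE PRESERVING `volume.prod volume → volume` (it is
  `toLp ∘ (piFinSuccAbove 2)⁻¹ ∘ (id × ofLp) ∘ swap`, each factor measure preserving);
* `lintegral_eq_lintegral_slices` — **Fubini along the axis**: `∫⁻ x, g x = ∫⁻ t, ∫⁻ y, g (y₀, y₁, t)` for measurable `g ≥ 0`;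
* `cylRadius_sliceMap` — `cylRadius (y₀,y₁,t) = ‖y‖` (and `(y₀,y₁,t)₂ = t` is `simp`, or the tree's
  `PlaneEnergyCeilingSlabEnergyIdentity.toLp_vec3_apply_two`);
* `hasFDerivAt_sliceMap`, `norm_sliceLinear_le_one`, `norm_fderiv_comp_sliceMap_le` — the slice map is affine with an isometric linear
  part, so `‖D(v ∘ slice_t)(y)‖ ≤ ‖Dv(slice_t y)‖` for differentiable `v`.
[folklore]

WHAT THIS IS NOT: not NS, not E, not H3 — measure/calculus plumbing `--supports` stmt-19832; 19832 is OPEN.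
-/

noncomputable section

-- flat `Theorems/<Route><Decl>…` files of one crux share the namespace of the crux (tree convention)
set_option linter.dupNamespace false

open MeasureTheory Set Filter Function WithLp
open scoped ENNReal Topology

namespace Summit.NavierStokesRegularity.NavierStokesRegularity.Theorems.PowerGaugeEulerLiouville.CasimirHaul

open Literature.Analysis.FluidPDE

section SliceMap

/-- `Fin.insertNth 2 t y = ![y 0, y 1, t]` on `Fin 3`. [folklore] -/
theorem insertNth_two_eq (t : ℝ) (y : Fin 2 → ℝ) : Fin.insertNth (α := fun _ => ℝ) (2 : Fin 3) t y = ![y 0, y 1, t] := by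
  ext i
  fin_cases i
  · have h : (0 : Fin 3) = (2 : Fin 3).succAbove 0 := by decide
    simp only [Fin.zero_eta, Matrix.cons_val_zero]
    rw [h, Fin.insertNth_apply_succAbove]
  · have h : (1 : Fin 3) = (2 : Fin 3).succAbove 1 := by decide
    simp only [Fin.mk_one, Matrix.cons_val_one, Matrix.cons_val_zero]
    rw [h, Fin.insertNth_apply_succAbove]
  · simp [Fin.insertNth_apply_same]

/-- The slice map as a composition of standard measurable equivalences. [folklore] -/
theorem sliceMap_eq_comp :
    (fun p : EuclideanSpace ℝ (Fin 2) × ℝ => (toLp 2 ![p.1 0, p.1 1, p.2] : EuclideanSpace ℝ (Fin 3))) =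
      (toLp 2 : (Fin 3 → ℝ) → EuclideanSpace ℝ (Fin 3)) ∘ (MeasurableEquiv.piFinSuccAbove (fun _ : Fin 3 => ℝ) 2).symm ∘
        (Prod.map id (ofLp : EuclideanSpace ℝ (Fin 2) → (Fin 2 → ℝ))) ∘ Prod.swap := by
  funext p
  obtain ⟨y, t⟩ := p
  rw [Function.comp_apply, Function.comp_apply, Function.comp_apply, MeasurableEquiv.piFinSuccAbove_symm_apply]
  show _ = toLp 2 (Fin.insertNth (α := fun _ => ℝ) 2 t (ofLp y))
  rw [insertNth_two_eq]

/-- **The slice map `(y, t) ↦ (y₀, y₁, t)` is measure preserving** (`ℝ² × ℝ → ℝ³`, Lebesgue measures). [folklore] -/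
theorem measurePreserving_sliceMap :
    MeasurePreserving (fun p : EuclideanSpace ℝ (Fin 2) × ℝ => (toLp 2 ![p.1 0, p.1 1, p.2] : EuclideanSpace ℝ (Fin 3)))
      (volume.prod volume) volume := by
  rw [sliceMap_eq_comp]
  refine (PiLp.volume_preserving_toLp (Fin 3)).comp ?_
  refine ((volume_preserving_piFinSuccAbove (fun _ : Fin 3 => ℝ) 2).symm _).comp ?_
  refine MeasurePreserving.comp (μb := volume.prod volume) ?_ (Measure.measurePreserving_swap)
  rw [show (volume : Measure (ℝ × (Fin 2 → ℝ))) = volume.prod volume from rfl]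
  exact (MeasurePreserving.id volume).prod (PiLp.volume_preserving_ofLp (Fin 2))

/-- Measurability of the slice map. [folklore] -/
theorem measurable_sliceMap :
    Measurable fun p : EuclideanSpace ℝ (Fin 2) × ℝ => (toLp 2 ![p.1 0, p.1 1, p.2] : EuclideanSpace ℝ (Fin 3)) :=
  measurePreserving_sliceMap.measurable

/-- **FUBINI ALONG THE AXIS**: `∫⁻ x, g x = ∫⁻ t, ∫⁻ y, g (y₀, y₁, t)` for measurable `g : ℝ³ → [0,∞]`. [folklore] -/
theorem lintegral_eq_lintegral_slices {g : EuclideanSpace ℝ (Fin 3) → ℝ≥0∞} (hg : Measurable g) :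
    ∫⁻ x, g x = ∫⁻ t : ℝ, ∫⁻ y : EuclideanSpace ℝ (Fin 2), g (toLp 2 ![y 0, y 1, t]) := by
  rw [← measurePreserving_sliceMap.lintegral_comp hg]
  exact lintegral_prod_symm (fun p : EuclideanSpace ℝ (Fin 2) × ℝ => g (toLp 2 ![p.1 0, p.1 1, p.2]))
    (hg.comp measurable_sliceMap).aemeasurable

/-- The cylindrical radius of a slice point is the planar norm. [folklore] -/
theorem cylRadius_sliceMap (y : EuclideanSpace ℝ (Fin 2)) (t : ℝ) : cylRadius (toLp 2 ![y 0, y 1, t]) = ‖y‖ := by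
  rw [cylRadius, EuclideanSpace.norm_eq, Fin.sum_univ_two]
  simp

end SliceMap

section Calculus

/-- The linear part of the slice map: `y ↦ (y₀, y₁, 0)`. [folklore] -/
theorem sliceLinear_exists :
    ∃ L : EuclideanSpace ℝ (Fin 2) →L[ℝ] EuclideanSpace ℝ (Fin 3),
      (∀ y, L y = toLp 2 ![y 0, y 1, 0]) ∧ ∀ y, ‖L y‖ = ‖y‖ := by
  let L₀ : EuclideanSpace ℝ (Fin 2) →ₗ[ℝ] EuclideanSpace ℝ (Fin 3) :=
    { toFun := fun y => toLp 2 ![y 0, y 1, 0]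
      map_add' := fun y z => by
        ext i; fin_cases i <;> simp
      map_smul' := fun c y => by
        ext i; fin_cases i <;> simp }
  have hnorm : ∀ y, ‖L₀ y‖ = ‖y‖ := fun y => by
    show ‖(toLp 2 ![y 0, y 1, 0] : EuclideanSpace ℝ (Fin 3))‖ = ‖y‖
    rw [EuclideanSpace.norm_eq, EuclideanSpace.norm_eq, Fin.sum_univ_three, Fin.sum_univ_two]
    simp
  refine ⟨LinearMap.toContinuousLinearMap L₀, fun y => rfl, hnorm⟩

/-- **The slice map is differentiable with an isometric linear part**, hence for differentiable `v`:
`‖D(v ∘ slice_t)(y)‖ ≤ ‖Dv(slice_t y)‖`. [folklore] -/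
theorem norm_fderiv_comp_sliceMap_le {F : Type*} [NormedAddCommGroup F] [NormedSpace ℝ F]
    {v : EuclideanSpace ℝ (Fin 3) → F} (t : ℝ) (y : EuclideanSpace ℝ (Fin 2))
    (hv : DifferentiableAt ℝ v (toLp 2 ![y 0, y 1, t])) :
    DifferentiableAt ℝ (fun y : EuclideanSpace ℝ (Fin 2) => v (toLp 2 ![y 0, y 1, t])) y ∧
      ‖fderiv ℝ (fun y : EuclideanSpace ℝ (Fin 2) => v (toLp 2 ![y 0, y 1, t])) y‖ ≤ ‖fderiv ℝ v (toLp 2 ![y 0, y 1, t])‖ := by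
  obtain ⟨L, hL, hLn⟩ := sliceLinear_exists
  -- `slice_t y = L y + (0,0,t)`
  have hslice : (fun y : EuclideanSpace ℝ (Fin 2) => (toLp 2 ![y 0, y 1, t] : EuclideanSpace ℝ (Fin 3))) =
      fun y => L y + toLp 2 ![0, 0, t] := by
    funext y
    rw [hL]
    ext i; fin_cases i <;> simp
  have hD : HasFDerivAt (fun y : EuclideanSpace ℝ (Fin 2) => (toLp 2 ![y 0, y 1, t] : EuclideanSpace ℝ (Fin 3))) L y := by
    rw [hslice]; exact L.hasFDerivAt.add_const _
  have hcomp : HasFDerivAt (fun y : EuclideanSpace ℝ (Fin 2) => v (toLp 2 ![y 0, y 1, t]))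
      ((fderiv ℝ v (toLp 2 ![y 0, y 1, t])).comp L) y := hv.hasFDerivAt.comp y hD
  refine ⟨hcomp.differentiableAt, ?_⟩
  rw [hcomp.fderiv]
  have hL1 : ‖L‖ ≤ 1 := L.opNorm_le_bound zero_le_one fun y => by rw [hLn, one_mul]
  calc ‖(fderiv ℝ v (toLp 2 ![y 0, y 1, t])).comp L‖ ≤ ‖fderiv ℝ v (toLp 2 ![y 0, y 1, t])‖ * ‖L‖ :=
        ContinuousLinearMap.opNorm_comp_le _ _
    _ ≤ ‖fderiv ℝ v (toLp 2 ![y 0, y 1, t])‖ * 1 := by gcongr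
    _ = _ := mul_one _

/-- The planar slice of a `C¹` map is `C¹`. [folklore] -/
theorem contDiff_comp_sliceMap {F : Type*} [NormedAddCommGroup F] [NormedSpace ℝ F] {v : EuclideanSpace ℝ (Fin 3) → F}
    {n : WithTop ℕ∞} (hv : ContDiff ℝ n v) (t : ℝ) :
    ContDiff ℝ n fun y : EuclideanSpace ℝ (Fin 2) => v (toLp 2 ![y 0, y 1, t]) := by
  obtain ⟨L, hL, -⟩ := sliceLinear_exists
  have hslice : (fun y : EuclideanSpace ℝ (Fin 2) => (toLp 2 ![y 0, y 1, t] : EuclideanSpace ℝ (Fin 3))) =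
      fun y => L y + toLp 2 ![0, 0, t] := by
    funext y
    rw [hL]
    ext i; fin_cases i <;> simp
  have h : ContDiff ℝ n fun y : EuclideanSpace ℝ (Fin 2) => (toLp 2 ![y 0, y 1, t] : EuclideanSpace ℝ (Fin 3)) := by
    rw [hslice]; exact L.contDiff.add contDiff_const
  exact hv.comp h

end Calculus

end Summit.NavierStokesRegularity.NavierStokesRegularity.Theorems.PowerGaugeEulerLiouville.CasimirHaul

end
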